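import Summits.ResolutionOfSingularities.ResolutionOfSingularities.Theorems.EquisingularLiftEquisingularLiftNatEquinodalNodeUnique
import Mathlib.RingTheory.Localization.AtPrime.Basic
import Mathlib.RingTheory.Ideal.Maps
import HarnessLib

/-!
# SCRATCH (res-L1-w45b-idea-3 g15, custody; NOT a proposal) — (N9c)/(N9d): the node-section uniqueness ✓ p672324 in the two shapes
# N-0 (w-iv)/(w-v) of stub-2's NU4-SIZING §E consumes («a horizontal singular point specialising to a node lies ON the node section»).

* `node_section_unique_map` (N9c): ✓ `Equinodal.node_section_unique'` pushed along ANY ring hom `ψ : O →+* O'` into a local ring.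
* `X_sub_C_mem_of_prime` (N9d): PRIME-IDEAL FORM — for a prime `𝔭` of `MvPolynomial (Fin 3) O` in the chart (`X 2 - 1 ∈ 𝔭`) lying on the
  relative singular scheme (`∂₀ g, ∂₁ g ∈ 𝔭`) and specialising to the node (`𝔭 ≤ ker (residue ∘ eval n)`), every `X j - C (n j)` lies in `𝔭`:
  the point is ON the section.  Proof: (N9c) with `O' := (B ⧸ 𝔭)` localised at the image of the node's maximal ideal, then injectivity of
  the localisation map of a domain.  No completeness, no finite extension of `O`, no Zariski main theorem.
OURS, counted 0; EL♮(3) NOT proved; nothing of [Hironaka2017]; AI-written, weaker than expert review.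
-/

set_option linter.dupNamespace false

noncomputable section

namespace NU4N9cd

open MvPolynomial IsLocalRing
open Summit.ResolutionOfSingularities.ResolutionOfSingularities.Cruxes.EquisingularLiftNat.Sections.Equinodal

/-- **(N9c) node-section uniqueness after ANY base change into a local ring.**  `ψ : O →+* O'` any ring hom with `O'` local; `n` the node
section over `O` in the chart `n 2 = 1` (`g(n) = 0`, `∇g(n) = 0`, Hessian minor a unit); `n'` an `O'`-point of `{∂₀ = ∂₁ = 0}` of `map ψ g` in the
chart reducing to the image of the node.  Then `n' = ψ ∘ n`. [OURS] -/
theorem node_section_unique_map {O O' : Type*} [CommRing O] [IsLocalRing O] [CommRing O'] [IsLocalRing O']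
    (ψ : O →+* O') (g : MvPolynomial (Fin 3) O) (n : Fin 3 → O) (n' : Fin 3 → O')
    (hchart : n 2 = 1) (hchart' : n' 2 = 1) (hres : ∀ j, residue O' (n' j) = residue O' (ψ (n j)))
    (hnode : eval n g = 0 ∧ ∀ j, eval n (pderiv j g) = 0)
    (hn' : eval n' (pderiv 0 (map ψ g)) = 0 ∧ eval n' (pderiv 1 (map ψ g)) = 0)
    (hhess : IsUnit (eval n (pderiv 0 (pderiv 0 g)) * eval n (pderiv 1 (pderiv 1 g))
      - eval n (pderiv 0 (pderiv 1 g)) ^ 2)) :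
    n' = ψ ∘ n := by
  have key : ∀ P : MvPolynomial (Fin 3) O, eval (ψ ∘ n) (map ψ P) = ψ (eval n P) :=
    fun P => (ringHom_eval ψ n P).symm
  refine node_section_unique' (map ψ g) (ψ ∘ n) n' ?_ hchart' (fun j => hres j) ?_ hn' ?_
  · simp [hchart]
  · refine ⟨by rw [key, hnode.1, map_zero], fun j => ?_⟩
    rw [pderiv_map, key, hnode.2 j, map_zero]
  · simp only [pderiv_map, key]
    rw [← map_pow ψ, ← map_mul ψ, ← map_sub ψ]
    exact hhess.map ψ

/-- **(N9d) prime-ideal form: a point of the relative singular scheme specialising to the node lies on the node section.**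
`O` any local ring, `n` the node section in the chart `n 2 = 1`; `𝔭` a prime of `B = MvPolynomial (Fin 3) O` with `X 2 - 1 ∈ 𝔭`,
`∂₀ g, ∂₁ g ∈ 𝔭`, and `𝔭 ≤ ker (residue ∘ eval n)` (= the maximal ideal of the node point of the special fibre).  Then
`X j - C (n j) ∈ 𝔭` for every `j`, i.e. `𝔭` contains the ideal of the section. [OURS] -/
theorem X_sub_C_mem_of_prime {O : Type*} [CommRing O] [IsLocalRing O]
    (g : MvPolynomial (Fin 3) O) (n : Fin 3 → O) (hchart : n 2 = 1)
    (hnode : eval n g = 0 ∧ ∀ j, eval n (pderiv j g) = 0)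
    (hhess : IsUnit (eval n (pderiv 0 (pderiv 0 g)) * eval n (pderiv 1 (pderiv 1 g))
      - eval n (pderiv 0 (pderiv 1 g)) ^ 2))
    (𝔭 : Ideal (MvPolynomial (Fin 3) O)) [𝔭.IsPrime]
    (hz : (X 2 : MvPolynomial (Fin 3) O) - 1 ∈ 𝔭)
    (hsing : pderiv 0 g ∈ 𝔭 ∧ pderiv 1 g ∈ 𝔭)
    (hsp : 𝔭 ≤ RingHom.ker ((residue O).comp (eval n))) :
    ∀ j, (X j : MvPolynomial (Fin 3) O) - C (n j) ∈ 𝔭 := by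
  classical
  -- the node's maximal ideal `𝔪n ⊇ 𝔭`, the domain `D = B ⧸ 𝔭`, the prime `P = 𝔪n / 𝔭`, the local ring `O' = D_P`
  let B := MvPolynomial (Fin 3) O
  let 𝔪n : Ideal B := RingHom.ker ((residue O).comp (eval n))
  have h𝔪n : 𝔪n.IsPrime := RingHom.ker_isPrime _
  let D := B ⧸ 𝔭
  let q : B →+* D := Ideal.Quotient.mk 𝔭
  haveI : IsDomain D := Ideal.Quotient.isDomain 𝔭
  let P : Ideal D := 𝔪n.map q
  haveI hP : P.IsPrime :=
    Ideal.map_isPrime_of_surjective Ideal.Quotient.mk_surjective (by rwa [Ideal.mk_ker])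
  let O' := Localization.AtPrime P
  let χ : B →+* O' := (algebraMap D O').comp q
  let ψ : O →+* O' := χ.comp C
  let n' : Fin 3 → O' := fun j => χ (X j)
  -- `χ` is evaluation at `n'` after mapping coefficients along `ψ`
  have hχ : ∀ p : B, eval n' (map ψ p) = χ p := by
    intro p
    rw [eval_map]
    show eval₂ (χ.comp C) (χ ∘ X) p = χ p
    rw [← eval₂_comp_left, eval₂_eta]
  -- membership in `𝔭` ⇒ `χ` kills it; membership in `𝔪n` ⇒ `χ` lands in the maximal ideal
  have hkill : ∀ p : B, p ∈ 𝔭 → χ p = 0 := by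
    intro p hp
    show algebraMap D O' (q p) = 0
    rw [Ideal.Quotient.eq_zero_iff_mem.mpr hp, map_zero]
  have hmax : ∀ p : B, p ∈ 𝔪n → χ p ∈ maximalIdeal O' := by
    intro p hp
    show algebraMap D O' (q p) ∈ maximalIdeal O'
    exact (IsLocalization.AtPrime.to_map_mem_maximal_iff O' P (q p)).mpr (Ideal.mem_map_of_mem q hp)
  have hsec : ∀ j, (X j : B) - C (n j) ∈ 𝔪n := by
    intro j
    show ((residue O).comp (eval n)) (X j - C (n j)) = 0
    simp
  -- apply (N9c)
  have hmain : n' = ψ ∘ n := by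
    refine node_section_unique_map ψ g n n' hchart ?_ ?_ hnode ?_ hhess
    · -- chart: `X 2 - 1 ∈ 𝔭`
      have h1 : χ (X 2 - 1) = 0 := hkill _ hz
      rw [map_sub, map_one, sub_eq_zero] at h1
      exact h1
    · intro j
      rw [← sub_eq_zero, ← map_sub, residue_eq_zero_iff]
      have : n' j - ψ (n j) = χ (X j - C (n j)) := by
        show χ (X j) - χ (C (n j)) = χ (X j - C (n j))
        rw [map_sub]
      rw [this]
      exact hmax _ (hsec j)
    · refine ⟨?_, ?_⟩
      · rw [pderiv_map, hχ]; exact hkill _ hsing.1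
      · rw [pderiv_map, hχ]; exact hkill _ hsing.2
  -- read off: `χ (X j - C (n j)) = 0`, and `algebraMap D O'` is injective on the domain `D`
  intro j
  have h0 : χ (X j - C (n j)) = 0 := by
    rw [map_sub, sub_eq_zero]
    show n' j = ψ (n j)
    rw [hmain]; rfl
  have h0' : algebraMap D O' (q (X j - C (n j))) = 0 := h0
  obtain ⟨m, hm⟩ := (IsLocalization.map_eq_zero_iff P.primeCompl O' _).mp h0'
  have hm0 : (m : D) ≠ 0 := fun h => m.2 (by rw [h]; exact P.zero_mem)
  have hq0 : q (X j - C (n j)) = 0 := by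
    rcases mul_eq_zero.mp hm with h | h
    · exact absurd h hm0
    · exact h
  exact Ideal.Quotient.eq_zero_iff_mem.mp hq0

end NU4N9cd

end
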